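import Summits.Ventures.Crystal3D.Theorems.StickyWulffConstantCoaxialWallLawBarlowPlateReadings
import Summits.Ventures.Crystal3D.Theorems.StickyWulffConstantCoaxialWallLawWordNoTop
import Summits.Ventures.Crystal3D.Theorems.StickyWulffConstantCoaxialWallLawWordStep
import HarnessLib

/-!
# NO ENTRY into the perfect plate of the OTHER orientation: the `hPexcl0` clause for the ONE-FCC F_layer cell (F_layer L3, OneFcc)

HONEST FRAMING. Venture `Summits/Ventures/Crystal3D` (cell `crystal3d-full`); helper `--supports` the crux `CoaxialWallLaw`
(stmt-Ventures-19481, REGISTERED line `WallLedgerF`) in its role as owner of lane T's debt T-F2 / F_layer; cf-p1 DECISION (civ)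
(2026-08-29T04:31:28Z): T-F2 target = `FLayerTwinFamilyOneFccAt (13/25) C 10` (…TexShadowFLayerSplitDefs) — one plate sign-constant
(fcc), the other any Hägg word; mechanism = the faulted plate's word net of the tree OPPOSITE to the fcc plate's orientation, which can
never enter the fcc plate.  Census-free, standard axioms; nothing about the crux is claimed; F-C1 not moved.  Sink memo
HOME/wall-19481-p1/g15/F-LAYER-SINKS-g15.md §2/§4(a).

THE EXCLUSION (registry-free, version-free).  Word data `(F, u, WF)` of the plate-abstract census (…PayerFamilyEndsPlates) over ANY
base frame `F []` with a BASAL root `u [] = r` (`r₂ = 0`), and a «receiving» set `P₂` of balls each FULL in a frame `G₂` whose slot dozen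
is the BASAL TWIN of the root dozen, `G₂ '' D = F [] '' (basalMirror '' D)`:

* **`hPexcl0_of_fullTwinPlate`** — no well-formed class `κ` reads an occupied `60°` face at a ball of `P₂` (whatever the state invariant):
  an occupied face at a FULL ball is a face of the `G₂`-dozen (`shell_slot_of_full`, `1`-separation), and no class of an in-plane root has
  a face inside the basal twin dozen (19481-p2's `word_noTop_of_inner_zero`).  This is the hypothesis `hPexcl0` of
  `word_family_endPairs_plates` / `word_endPairs_multi_plates` VERBATIM, for every invariant `P`;
* `twinDozen_eq_frame` / `twinDozen_eq_mirrorFrame` — the dozen hypothesis in the two cases of the cell: root frame `F [] = basalMirror ≫ L`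
  (tree `D₋` of a plate presented by `L`) against receiving frame `G₂ = L` (dozen `D₊`), and root frame `F [] = L` against `G₂ = basalMirror ≫ L`;
* `isFull_constPlateBall_pos` / `isFull_constPlateBall_neg` — the deep balls of a clamped SIGN-CONSTANT Barlow plate `stacking L s σ`
  (`σ ≡ 1`, resp. `σ ≡ −1`) are FULL in `L`, resp. in `basalMirror ≫ L` (p690727's c-layer readings with constant signs).
ON THE ROWS (cf-p1 (civ): «confirm 𝒰_cx ⊇ the Barlow-side payer windows»): the on-site universe `coaxialModuleUniverse`
(…EndRowCoaxialModuleDefs) consists of the `1`-separated windows on the coaxial MODULE (all three letters in every basal layer), and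
`barlowStacking_subset_coaxialModule` puts every Barlow stacking with the common basal frame on it — so a payer window whose balls are sites
of EITHER plate of a twin-family OneFcc cell (same basal frame `P`, any two Hägg words, any A/B/C registries) is a module window; the
filling's off-module balls are the tail's business exactly as in the fcc cells.  (Bookkeeping statement only; the row files are not touched.)
WHAT THIS IS NOT: not the flux count, not the assembly; F-C1 not moved.
-/

noncomputable section

namespace Summit.Ventures.Crystal3D.Theorems

open Summit.Ventures.Crystal3D Finset
open Literature.MathematicalPhysics.StatisticalMechanics (barlowPos barlowStacking IsHaggSeq barlowPos_mem basalMirror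
  basalMirror_basalMirror)
open Summit.Ventures.Crystal3D.Cruxes.TextureLiminf.TexShadow (E3 stacking)
open scoped InnerProductSpace

/-! ### The exclusion -/

section NoEntry

variable {X : Finset E3} (hX : ∀ p ∈ X, ∀ q ∈ X, p ≠ q → 1 ≤ dist p q)
  {F : List E3 → (E3 ≃ₗᵢ[ℝ] E3)} {u : List E3 → E3} {WF : List E3 → Prop}
  (hFc : ∀ μ κ, F (μ :: κ) = ((ℝ ∙ μ)ᗮ.reflection).trans (F κ))
  (huc : ∀ μ κ, u (μ :: κ) = -u κ)
  (hWFc : ∀ μ κ, WF (μ :: κ) ↔ (WF κ ∧ ‖μ‖ = 1 ∧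
    (∀ w ∈ fccSlots, ⟪w, μ⟫_ℝ = 0 ∨ ⟪w, μ⟫_ℝ = Real.sqrt (2 / 3) ∨ ⟪w, μ⟫_ℝ = -Real.sqrt (2 / 3)) ∧
    ⟪u κ, μ⟫_ℝ = Real.sqrt (2 / 3) ∧ ∀ μ' κ', κ = μ' :: κ' → μ' ≠ -μ))
  (hu2 : (u []) 2 = 0)
  (G₂ : E3 ≃ₗᵢ[ℝ] E3)
  (hG₂ : (G₂ : E3 → E3) '' ↑fccSlots = (fun x => F [] (basalMirror x)) '' ↑fccSlots)
  {P₂ : Finset E3} (hP₂full : ∀ b ∈ P₂, IsFull X G₂ b)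

include hX hFc huc hWFc hu2 hG₂ hP₂full

/-- **`hPexcl0` for a receiving plate FULL in the basal-twin dozen of the root frame**: no well-formed class of the in-plane
root reads an occupied `60°` face at a ball of `P₂` — for every state invariant `P`. -/
theorem hPexcl0_of_fullTwinPlate (P : E3 × List E3 → Prop) :
    ∀ (b : E3) (κ : List E3), WF κ → P (b, κ) → b ∈ P₂ →
      (∃ a ∈ fccSlots, ∃ a' ∈ fccSlots, ∃ a'' ∈ fccSlots,
        ⟪a, a'⟫_ℝ = 1 / 2 ∧ ⟪a, a''⟫_ℝ = 1 / 2 ∧ ⟪a', a''⟫_ℝ = 1 / 2 ∧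
        b + F κ a ∈ X ∧ b + F κ a' ∈ X ∧ b + F κ a'' ∈ X) → False := by
  intro b κ hκ _ hb htri
  set e₃ : E3 := EuclideanSpace.single (2 : Fin 3) (1 : ℝ) with he₃
  have he₃1 : ‖e₃‖ = 1 := by rw [he₃, PiLp.norm_single, norm_one]
  have hmenu : ∀ w ∈ fccSlots, ⟪w, e₃⟫_ℝ = 0 ∨ ⟪w, e₃⟫_ℝ = Real.sqrt (2 / 3) ∨ ⟪w, e₃⟫_ℝ = -Real.sqrt (2 / 3) := by
    intro w hw; rw [inner_single_two_one]; exact slot_apply_two_cases hw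
  have horth : ⟪u [], e₃⟫_ℝ = 0 := by rw [inner_single_two_one, hu2]
  have hG₂' : (G₂ : E3 → E3) '' ↑fccSlots = (fun x => F [] (x - (2 * ⟪x, e₃⟫_ℝ) • e₃)) '' ↑fccSlots := by
    rw [hG₂]
    refine Set.image_congr fun x _ => ?_
    show F [] (basalMirror x) = F [] (x - (2 * ⟪x, e₃⟫_ℝ) • e₃)
    rw [basalMirror, reflection_unit_apply he₃1]
  have hGfull := hP₂full b hb
  obtain ⟨a, ha, a', ha', a'', ha'', i1, i2, i3, h1, h2, h3⟩ := htri
  refine word_noTop_of_inner_zero hFc huc hWFc he₃1 hmenu horth G₂ hG₂' hκ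
    ⟨a, ha, a', ha', a'', ha'', i1, i2, i3, ?_, ?_, ?_⟩
  · exact shell_slot_of_full hX G₂ hGfull h1 (by rw [LinearIsometryEquiv.norm_map, norm_eq_one_of_mem_fccSlots ha])
  · exact shell_slot_of_full hX G₂ hGfull h2 (by rw [LinearIsometryEquiv.norm_map, norm_eq_one_of_mem_fccSlots ha'])
  · exact shell_slot_of_full hX G₂ hGfull h3 (by rw [LinearIsometryEquiv.norm_map, norm_eq_one_of_mem_fccSlots ha''])

end NoEntry

/-! ### The dozen hypothesis in the two cases of the cell -/

/-- Root frame `basalMirror ≫ L` (tree `D₋`) against receiving frame `L` (dozen `D₊`). -/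
theorem twinDozen_eq_frame (L : E3 ≃ₗᵢ[ℝ] E3) {F : List E3 → (E3 ≃ₗᵢ[ℝ] E3)} (hF0 : F [] = basalMirror.trans L) :
    (L : E3 → E3) '' ↑fccSlots = (fun x => F [] (basalMirror x)) '' ↑fccSlots := by
  refine Set.image_congr fun x _ => ?_
  rw [hF0, LinearIsometryEquiv.trans_apply, basalMirror_basalMirror]

/-- Root frame `L` (tree `D₊`) against receiving frame `basalMirror ≫ L` (dozen `D₋`). -/
theorem twinDozen_eq_mirrorFrame (L : E3 ≃ₗᵢ[ℝ] E3) {F : List E3 → (E3 ≃ₗᵢ[ℝ] E3)} (hF0 : F [] = L) :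
    ((basalMirror.trans L : E3 ≃ₗᵢ[ℝ] E3) : E3 → E3) '' ↑fccSlots = (fun x => F [] (basalMirror x)) '' ↑fccSlots := by
  refine Set.image_congr fun x _ => ?_
  rw [hF0, LinearIsometryEquiv.trans_apply]

/-! ### The deep balls of a clamped sign-constant plate are FULL -/

section ConstPlate

variable {σ : ℤ → ℤ} (L : E3 ≃ₗᵢ[ℝ] E3) (s : E3) {X : Finset E3}
  (hsep : ∀ p ∈ X, ∀ p' ∈ X, p ≠ p' → 1 ≤ dist p p') {W : Set E3}
  (hplate : ∀ p ∈ stacking L s σ, p ∈ W → p ∈ X) (k i j : ℤ)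
  (hW : ∀ x, dist (L (barlowPos 1 (Real.sqrt (2 / 3)) σ k i j) + s) x ≤ 2 → x ∈ W)

include hsep hplate hW

open scoped Classical in
/-- All signs `+1`: FULL in the plate frame `L`. -/
theorem isFull_constPlateBall_pos (hσ : ∀ n : ℤ, σ n = 1) :
    IsFull X L (L (barlowPos 1 (Real.sqrt (2 / 3)) σ k i j) + s) :=
  isFull_plateBall L s hsep hplate k i j hW (hσ _) (hσ _)

open scoped Classical in
/-- All signs `−1`: FULL in the mirror frame `basalMirror ≫ L`. -/
theorem isFull_constPlateBall_neg (hσ : ∀ n : ℤ, σ n = -1) :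
    IsFull X (basalMirror.trans L) (L (barlowPos 1 (Real.sqrt (2 / 3)) σ k i j) + s) :=
  isFull_mirror_plateBall L s hsep hplate k i j hW (hσ _) (hσ _)

omit hW in
open scoped Classical in
/-- **`hP₂full` for a clamped sign-constant plate**, both signs at once: every ball of a finite set `P₂` of deep plate balls is
FULL in `L` (if `σ ≡ 1`) or in `basalMirror ≫ L` (if `σ ≡ −1`). -/
theorem isFull_of_constPlateCore (P₂ : Finset E3)
    (hP₂ : ∀ p ∈ P₂, ∃ k i j : ℤ, p = L (barlowPos 1 (Real.sqrt (2 / 3)) σ k i j) + s ∧ ∀ x, dist p x ≤ 2 → x ∈ W)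
    {ε : ℤ} (hε : ε = 1 ∨ ε = -1) (hσ : ∀ n : ℤ, σ n = ε) :
    ∀ b ∈ P₂, IsFull X (if ε = 1 then L else basalMirror.trans L) b := by
  intro b hb
  obtain ⟨k', i', j', rfl, hW'⟩ := hP₂ b hb
  rcases hε with rfl | rfl
  · rw [if_pos rfl]; exact isFull_plateBall L s hsep hplate k' i' j' hW' (hσ _) (hσ _)
  · rw [if_neg (by norm_num)]; exact isFull_mirror_plateBall L s hsep hplate k' i' j' hW' (hσ _) (hσ _)

end ConstPlate

end Summit.Ventures.Crystal3D.Theorems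

end
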